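import Summits.ResolutionOfSingularities.ResolutionOfSingularities.Theorems.MarkedTransferCampaignW46MohWindowSurfaceStep
import Literature.AlgebraicGeometry.Resolution.BlowupDimension
import HarnessLib

/-!
# [OURS · L1 W4.6 rung (iii-2), HEAVY-ROOT SIDE, `p = 2`] Surface Moh window — the blow-up of a PURE cube child: every singular
# point over it has the frozen shape (cell res-hironaka, LADDER-RESOLUTION rung L, D-0089; seat res-L1-s46-pv-5 gen 4; host
# MarkedTransfer, `--supports stmt-ResolutionOfSingularities-16155 --as helper`; statement file `…CampaignW46MohWindowSurface.lean`)

HONEST FRAMING. Nothing here is a statement of H. Hironaka's manuscript [Hironaka2017] and nothing here asserts that any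
statement of it holds. COMMUTATIVE ALGEBRA in the Rees chart (tree `BlowupChartRsop`, `BlowupDimension`) plus the scheme-level
transport of res-D-pv-050's `…MohWindowSurfaceStep.lean` pattern; step (4) of res-L1-s46-pv-5's «p = 2 programme» (NOTES).
AI-written; AI review is weaker than expert review. No `sorry`; axioms standard.

THE POINT. A PURE cube child is a point `y` whose window ideal is `J_y = (w² + s²η + s q³ G)` in a regular system of parameters
`(s, q, w)` with `G` a unit and `η ≡ η_S s + η_Q q + η_W w (mod 𝔪²)`, `η_S` a UNIT, `η_Q ∈ 𝔪` (residue cubic `c·S³`: the heavy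
direction is the exceptional curve `s = 0`; companion `…CubeChild.lean`). Blow `y` up. `pureChild_of_chart` (ring level, the three
Rees charts): a point of the blow-up over `y` at which the transform `J′ = ((ψ g) : (ψ c_j)²)` is singular lies in the chart of
`q` at its origin (`e_s, e_w ∈ 𝔴`; the charts of `s` and `w` carry no singular point: there the transform has order `≤ 1`), its
local ring is regular of embedding dimension `3` with parameters `(q′, e_s, e_w)` (`chartOrigin_span_triple_eq`), and
`J′ = (e_w² + q′²·(e_s G) + q′ e_s² η̃)` with `η̃ ∈ 𝔪` — the FROZEN shape of `…FrozenShape.lean` (`η′ = e_s·G`: unit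
`q′`-component... read with `s′ = q′`, `q′′ = e_s`: `η′ ≡ G · e_s`, unit coefficient along the non-exceptional letter). Scheme level
(`exists_frozenShape_of_over_pure`): for a permissible blow-up of a state of `Regime.mohWindowSurface` (`p = 2`) at such a `y`, every
singular point of the transform over `y` carries frozen-shape data; with `…FrozenShape.lean` + `…Freeze.lean` it is never again
an admitted centre inside the regime (`not_mohWindowSurface_transform_of_over_pure`). [ZariskiSamuel1960] [Matsumura1987]
[StacksProject, Tag 0804]
-/

noncomputable section

set_option linter.dupNamespace false -- mandated namespace of this single-conjunct summit

open CategoryTheory AlgebraicGeometry TopologicalSpace IsLocalRing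

namespace Summit.ResolutionOfSingularities.ResolutionOfSingularities.Theorems

namespace CampaignW46

open Literature.AlgebraicGeometry.Resolution
open Literature.AlgebraicGeometry.Hironaka2017.S02Preliminaries
open Literature.AlgebraicGeometry.Hironaka2017.Datum
open Literature.AlgebraicGeometry.Hironaka2017.S16Proof
open Scheme.IdealSheafData

universe u

namespace MohWindowSurface

/-! ## 1. The origin of a Rees chart in embedding dimension `3` -/

/-- **At the origin of the chart `D₊(c_j t)` the triple `(c_j, c_i/c_j, c_{i'}/c_j)` is a regular system of parameters.** `R`
regular local of embedding dimension `3` with regular system of parameters `c`; `𝔴` a prime of the chart ring `R[𝔪/c_j]` over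
`𝔪_R` containing the two other chart generators; `L` a localisation at `𝔴`: `L` is regular of embedding dimension `3` and
`𝔪_L = (c_j, e_i, e_{i'})` (tree `isRsopPart_chartFamily_reesChart` + `dim L ≤ dim R`, `ringKrullDim_localization_chartRing_le`).
[cite: StacksProject, Tag 0BIQ] -/
theorem chartOrigin_span_triple_eq {R : Type u} [CommRing R] [IsRegularLocalRing R] (h3 : (maximalIdeal R).spanFinrank = 3)
    (c : Fin 3 → R) (hc : Ideal.span (Set.range c) = maximalIdeal R) {i i' j : Fin 3} (hij : i ≠ j) (hi'j : i' ≠ j)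
    (hii' : i ≠ i') (𝔴 : Ideal (chartRing c j)) [𝔴.IsPrime] (h𝔴 : 𝔴.comap (chartBase c j) = maximalIdeal R)
    (hi : chartGen c j i ∈ 𝔴) (hi' : chartGen c j i' ∈ 𝔴)
    (L : Type u) [CommRing L] [IsLocalRing L] [Algebra (chartRing c j) L] [IsLocalization.AtPrime L 𝔴] :
    IsRegularLocalRing L ∧ (maximalIdeal L).spanFinrank = 3 ∧
      Ideal.span {(algebraMap (chartRing c j) L : chartRing c j →+* L) (chartBase c j (c j)),
        (algebraMap (chartRing c j) L : chartRing c j →+* L) (chartGen c j i),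
        (algebraMap (chartRing c j) L : chartRing c j →+* L) (chartGen c j i')} = maximalIdeal L := by
  classical
  have hz : Ideal.span (Set.range (Fin.append c (fun k : Fin 0 => Fin.elim0 k))) = maximalIdeal R := by
    rw [span_range_append_elim0]; exact hc
  set jJ : Fin 2 → {k : Fin 3 // k ≠ j} := ![⟨i, hij⟩, ⟨i', hi'j⟩] with hjJ_def
  have hjJ : Function.Injective jJ := by
    intro a b hab
    fin_cases a <;> fin_cases b
    · rfl
    · exfalso; apply hii'; simpa [hjJ_def] using congrArg Subtype.val hab
    · exfalso; apply hii'; simpa [hjJ_def] using (congrArg Subtype.val hab).symm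
    · rfl
  have hmem : ∀ k, chartGen c j (jJ k).1 ∈ 𝔴 := fun k => by
    fin_cases k
    · simpa [hjJ_def] using hi
    · simpa [hjJ_def] using hi'
  have hrsop := isRsopPart_chartFamily_reesChart c j (fun k : Fin 0 => Fin.elim0 k) hz (by rw [h3]) 𝔴 h𝔴 L jJ hjJ hmem
  obtain ⟨hLreg, e, yv, hdimL, hspan⟩ := hrsop
  haveI := hLreg
  haveI := isDomain_of_isRegularLocalRing R
  have hdimR : ringKrullDim R = (3 : ℕ) := by
    rw [← IsRegularLocalRing.spanFinrank_maximalIdeal, h3]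
  have hle : ringKrullDim L ≤ ringKrullDim R := ringKrullDim_localization_chartRing_le c j 𝔴 h𝔴 L
  rw [hdimL, hdimR] at hle
  have he : e = 0 := by
    have : (2 + 0 + 1 + e : ℕ) ≤ 3 := by exact_mod_cast hle
    omega
  subst he
  have hspan' : Ideal.span (Set.range (chartFamily c j (fun k : Fin 0 => Fin.elim0 k) L (chartBase c j)
      (chartGen c j) jJ)) = maximalIdeal L := by
    rw [← hspan, Set.range_eq_empty yv, Set.union_empty]
  refine ⟨hLreg, ?_, ?_⟩
  · have h := IsRegularLocalRing.spanFinrank_maximalIdeal (R := L)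
    rw [hdimL] at h
    exact_mod_cast h
  · apply le_antisymm
    · rw [Ideal.span_le]
      rintro z (rfl | rfl | rfl)
      · exact (IsLocalization.AtPrime.to_map_mem_maximal_iff _ 𝔴 _).mpr
          (by rw [← Ideal.mem_comap, h𝔴, ← hc]; exact Ideal.subset_span ⟨j, rfl⟩)
      · exact (IsLocalization.AtPrime.to_map_mem_maximal_iff _ 𝔴 _).mpr hi
      · exact (IsLocalization.AtPrime.to_map_mem_maximal_iff _ 𝔴 _).mpr hi'
    · rw [← hspan', Ideal.span_le]
      rintro _ ⟨k, rfl⟩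
      refine Fin.cases ?_ (fun k' => ?_) k
      · simp only [chartFamily, Fin.cons_zero]
        exact Ideal.subset_span (Or.inl rfl)
      · simp only [chartFamily, Fin.cons_succ]
        have hk : k' = Fin.castAdd 0 k' := rfl
        rw [hk, Fin.append_left]
        fin_cases k'
        · simp only [hjJ_def]
          exact Ideal.subset_span (Or.inr (Or.inl rfl))
        · simp only [hjJ_def]
          exact Ideal.subset_span (Or.inr (Or.inr rfl))

/-! ## 2. Ring level: the transform of a pure cube child in the three charts -/

/-- **[OURS · L1 W4.6 rung (iii-2), `p = 2`] PURE CUBE CHILD, ring level.** `R → L` (`ψ`) the stalk map at a point of the blow-up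
of a point `y` with regular system of parameters `c = (s, q, w)` and window ideal generated by `g = w² + (s²η + s q³ G)`, `G`
a unit, `η ≡ η_S s + η_Q q + η_W w (mod 𝔪²)` with `η_S` a unit and `η_Q ∈ 𝔪` (PURE cube child), presented through the Rees chart
`j` (`L` a localisation of `R[𝔪/c_j]` at a prime `𝔴` over `𝔪_R`). If the transform ideal `I′ = ((ψ g) : (ψ c_j)²)` lies in `𝔪_L²`
(the point is singular for exponent `2`), then `L` is regular of embedding dimension `3` and `I′ = (w′² + (s′² η′ + r′))` for a
regular system of parameters `(s′, q′, w′)` of `L` with `η′ = G′ · q′` (`G′` a unit: the FROZEN shape, unit `q′`-component) and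
`r′ ∈ 𝔪_L⁴` — in fact `j` is the chart of `q`, the point is its origin, `s′ = ψ q`, `q′ = s/q`, `w′ = w/q`. NOT a statement of
the manuscript. [folklore] -/
theorem pureChild_of_chart {R : Type u} [CommRing R] [IsRegularLocalRing R]
    (h3 : (maximalIdeal R).spanFinrank = 3) (c : Fin 3 → R) (hc : Ideal.span (Set.range c) = maximalIdeal R)
    {η G η_S η_Q η_W : R} (hη : η - (η_S * c 0 + η_Q * c 1 + η_W * c 2) ∈ maximalIdeal R ^ 2) (hηS : IsUnit η_S)
    (hηQ : η_Q ∈ maximalIdeal R) (hG : IsUnit G) (j : Fin 3)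
    (𝔴 : Ideal (chartRing c j)) [𝔴.IsPrime] (h𝔴 : 𝔴.comap (chartBase c j) = maximalIdeal R)
    (L : Type u) [CommRing L] [IsLocalRing L] [Algebra (chartRing c j) L] [IsLocalization.AtPrime L 𝔴]
    (ψ : R →+* L) (hψ : ∀ r, ψ r = (algebraMap (chartRing c j) L : chartRing c j →+* L) (chartBase c j r))
    {I' : Ideal L}
    (hI' : I' = Submodule.colon (Ideal.span {ψ (c 2 ^ 2 + (c 0 ^ 2 * η + c 0 * c 1 ^ 3 * G))})
      ((Ideal.span {ψ (c j)} ^ 2 : Ideal L) : Set L))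
    (hsing : I' ≤ maximalIdeal L ^ 2) :
    IsRegularLocalRing L ∧ (maximalIdeal L).spanFinrank = 3 ∧
      ∃ s' q' w' G' r' : L, Ideal.span {s', q', w'} = maximalIdeal L ∧ IsUnit G' ∧ r' ∈ maximalIdeal L ^ 4 ∧
        I' = Ideal.span {w' ^ 2 + (s' ^ 2 * (G' * q') + r')} := by
  classical
  set alg : chartRing c j →+* L := (algebraMap (chartRing c j) L : chartRing c j →+* L) with halg
  -- `ψ (c j)` is a regular parameter of `L`
  have hz0 : Ideal.span (Set.range (Fin.append c (fun k : Fin 0 => Fin.elim0 k : Fin 0 → R))) = maximalIdeal R := by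
    rw [span_range_append_elim0]; exact hc
  have hd0 : (maximalIdeal R).spanFinrank = 3 + 0 := by rw [h3]
  have hrsop := isRsopPart_chartFamily_reesChart c j (fun k : Fin 0 => Fin.elim0 k) hz0 hd0 𝔴 h𝔴 L
    (a := 0) (fun k : Fin 0 => Fin.elim0 k) (Function.injective_of_subsingleton _) (fun k => Fin.elim0 k)
  haveI hLreg : IsRegularLocalRing L := hrsop.isRegularLocalRing
  haveI : IsDomain L := isDomain_of_isRegularLocalRing L
  set t : L := ψ (c j) with htdef
  have ht : t ∈ maximalIdeal L := by
    have h0 := hrsop.mem_maximalIdeal 0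
    rw [htdef, hψ]; simpa only [chartFamily, Fin.cons_zero] using h0
  have ht0 : t ≠ 0 := by
    have h0 := hrsop.ne_zero 0
    rw [htdef, hψ]; simpa only [chartFamily, Fin.cons_zero] using h0
  have ht2 : t ∉ maximalIdeal L ^ 2 := by
    have h0 := hrsop.not_mem_sq 0
    rw [htdef, hψ]; simpa only [chartFamily, Fin.cons_zero] using h0
  -- chart relations
  have hrel : ∀ l, ψ (c l) = t * alg (chartGen c j l) := fun l => by
    rw [htdef, hψ, hψ, halg, ← map_mul, ← reesChartBase_apply_eq_mul_chartGen c j l]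
  have hej : alg (chartGen c j j) = 1 := by
    have h1 : t * alg (chartGen c j j) = t * 1 := by rw [mul_one, ← hrel j]
    exact mul_left_cancel₀ ht0 h1
  -- `ψ` is local: `ψ 𝔪_R = (t)`
  have hψm : ∀ r ∈ maximalIdeal R, ψ r ∈ Ideal.span {t} := by
    intro r hr
    have hr' : r ∈ Ideal.span (Set.range c) := hc ▸ hr
    have : (Ideal.span (Set.range c)).map ψ = Ideal.span {t} := Ideal.map_span_range_eq_span_singleton _ c j _ hrel
    rw [← this]
    exact Ideal.mem_map_of_mem _ hr'
  have hψm' : ∀ r ∈ maximalIdeal R, ψ r ∈ maximalIdeal L := fun r hr =>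
    (Ideal.span_le.mpr (Set.singleton_subset_iff.mpr ht)) (hψm r hr)
  -- `ψ η = t · η₁` with `η₁ ≡ η_S e_s + η_Q e_q + η_W e_w (mod t)`
  obtain ⟨r₂', hr₂'⟩ : ∃ r₂' : L, ψ (η - (η_S * c 0 + η_Q * c 1 + η_W * c 2)) = t ^ 2 * r₂' := by
    have hmem : ψ (η - (η_S * c 0 + η_Q * c 1 + η_W * c 2)) ∈ Ideal.span {t} ^ 2 := by
      have : (maximalIdeal R ^ 2).map ψ = Ideal.span {t} ^ 2 := by
        rw [Ideal.map_pow, ← hc, Ideal.map_span_range_eq_span_singleton _ c j _ hrel]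
      rw [← this]; exact Ideal.mem_map_of_mem _ hη
    rw [Ideal.span_singleton_pow, Ideal.mem_span_singleton'] at hmem
    obtain ⟨r, hr⟩ := hmem
    exact ⟨r, by rw [← hr, mul_comm]⟩
  set η₁ : L := ψ η_S * alg (chartGen c j 0) + ψ η_Q * alg (chartGen c j 1) + ψ η_W * alg (chartGen c j 2) + t * r₂' with hη₁
  have hψη : ψ η = t * η₁ := by
    have : ψ η = ψ (η_S * c 0 + η_Q * c 1 + η_W * c 2) + ψ (η - (η_S * c 0 + η_Q * c 1 + η_W * c 2)) := by
      rw [← map_add]; congr 1; ring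
    rw [this, hr₂', map_add, map_add, map_mul, map_mul, map_mul, hrel 0, hrel 1, hrel 2, hη₁]
    ring
  have hηQ' : ψ η_Q ∈ maximalIdeal L := hψm' _ hηQ
  have hηS' : IsUnit (ψ η_S) := hηS.map ψ
  have hG' : IsUnit (ψ G) := hG.map ψ
  -- the pulled-back equation
  have hψg : ψ (c 2 ^ 2 + (c 0 ^ 2 * η + c 0 * c 1 ^ 3 * G)) =
      t ^ 2 * (alg (chartGen c j 2) ^ 2 + (t * alg (chartGen c j 0) ^ 2 * η₁ +
        t ^ 2 * alg (chartGen c j 0) * alg (chartGen c j 1) ^ 3 * ψ G)) := by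
    rw [map_add, map_add, map_pow, map_mul, map_mul, map_mul, map_pow, map_pow, hrel 2, hrel 0, hrel 1, hψη]
    ring
  set g₁ : L := alg (chartGen c j 2) ^ 2 + (t * alg (chartGen c j 0) ^ 2 * η₁ +
    t ^ 2 * alg (chartGen c j 0) * alg (chartGen c j 1) ^ 3 * ψ G) with hg₁
  have hI'eq : I' = Ideal.span {g₁} := by
    rw [hI', hψg, colon_span_pow_mul (mem_nonZeroDivisors_of_ne_zero ht0)]
  have hg₁m : g₁ ∈ maximalIdeal L ^ 2 := hsing (by rw [hI'eq]; exact Ideal.mem_span_singleton_self _)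
  -- `e_w ∈ 𝔪_L`
  have hew : alg (chartGen c j 2) ∈ maximalIdeal L := by
    have h1 : t * alg (chartGen c j 0) ^ 2 * η₁ + t ^ 2 * alg (chartGen c j 0) * alg (chartGen c j 1) ^ 3 * ψ G ∈
        maximalIdeal L := by
      refine Ideal.add_mem _ ?_ ?_
      · exact Ideal.mul_mem_right _ _ (Ideal.mul_mem_right _ _ ht)
      · exact Ideal.mul_mem_right _ _ (Ideal.mul_mem_right _ _ (Ideal.mul_mem_right _ _ (Ideal.pow_mem_of_mem _ ht 2 two_pos)))
    have h2 : alg (chartGen c j 2) ^ 2 ∈ maximalIdeal L := by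
      have := Ideal.sub_mem _ (Ideal.pow_le_self two_ne_zero hg₁m) h1
      rwa [hg₁, add_sub_cancel_right] at this
    exact (maximalIdeal.isMaximal L).isPrime.mem_of_pow_mem 2 h2
  -- the key dichotomy tool: `e_w² + t · v ∈ 𝔪²` with `v` a unit is impossible
  have key : ∀ {v : L}, IsUnit v → alg (chartGen c j 2) ^ 2 + t * v ∈ maximalIdeal L ^ 2 → False := by
    intro v hv hmem
    have h1 : t * v ∈ maximalIdeal L ^ 2 := by
      have := Ideal.sub_mem _ hmem (Ideal.pow_mem_pow hew 2)
      rwa [add_sub_cancel_left] at this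
    have : v * t ^ 1 ∈ maximalIdeal L ^ (1 + 1) := by rw [pow_one, mul_comm]; exact h1
    exact unit_mul_pow_not_mem_pow_succ ht2 hv 1 this
  -- which chart?
  obtain rfl | rfl | rfl : j = 0 ∨ j = 1 ∨ j = 2 := by
    rcases j with ⟨j, hj⟩
    have : j = 0 ∨ j = 1 ∨ j = 2 := by omega
    rcases this with rfl | rfl | rfl
    · exact Or.inl rfl
    · exact Or.inr (Or.inl rfl)
    · exact Or.inr (Or.inr rfl)
  · -- chart `s`: `e_s = 1`, `η₁` is a unit, order one — impossible
    exfalso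
    have hη₁u : IsUnit η₁ := by
      rw [hη₁, hej, mul_one]
      by_contra hnu
      have hm : ψ η_S + ψ η_Q * alg (chartGen c 0 1) + ψ η_W * alg (chartGen c 0 2) + t * r₂' ∈ maximalIdeal L :=
        (mem_maximalIdeal _).mpr (mem_nonunits_iff.mpr hnu)
      have : ψ η_S ∈ maximalIdeal L := by
        have h1 : ψ η_Q * alg (chartGen c 0 1) + ψ η_W * alg (chartGen c 0 2) + t * r₂' ∈ maximalIdeal L :=
          Ideal.add_mem _ (Ideal.add_mem _ (Ideal.mul_mem_right _ _ hηQ') (Ideal.mul_mem_left _ _ hew))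
            (Ideal.mul_mem_right _ _ ht)
        have := Ideal.sub_mem _ hm h1
        rwa [show ψ η_S + ψ η_Q * alg (chartGen c 0 1) + ψ η_W * alg (chartGen c 0 2) + t * r₂' -
          (ψ η_Q * alg (chartGen c 0 1) + ψ η_W * alg (chartGen c 0 2) + t * r₂') = ψ η_S from by ring] at this
      exact (maximalIdeal.isMaximal L).ne_top (Ideal.eq_top_of_isUnit_mem _ this hηS')
    refine key (v := η₁ + t * alg (chartGen c 0 1) ^ 3 * ψ G) ?_ ?_
    · -- unit + element of `𝔪`
      by_contra hnu
      have hm : η₁ + t * alg (chartGen c 0 1) ^ 3 * ψ G ∈ maximalIdeal L :=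
        (mem_maximalIdeal _).mpr (mem_nonunits_iff.mpr hnu)
      have : η₁ ∈ maximalIdeal L := by
        have := Ideal.sub_mem _ hm (Ideal.mul_mem_right _ _ (Ideal.mul_mem_right _ _ ht) :
          t * alg (chartGen c 0 1) ^ 3 * ψ G ∈ maximalIdeal L)
        rwa [add_sub_cancel_right] at this
      exact (maximalIdeal.isMaximal L).ne_top (Ideal.eq_top_of_isUnit_mem _ this hη₁u)
    · have : alg (chartGen c 0 2) ^ 2 + t * (η₁ + t * alg (chartGen c 0 1) ^ 3 * ψ G) = g₁ := by
        rw [hg₁, hej]; ring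
      rw [this]; exact hg₁m
  · -- chart `q`: the origin, frozen shape
    -- `e_s ∈ 𝔪_L`
    have hes : alg (chartGen c 1 0) ∈ maximalIdeal L := by
      by_contra hesu
      have hesU : IsUnit (alg (chartGen c 1 0)) :=
        not_not.mp fun h => hesu ((mem_maximalIdeal _).mpr (mem_nonunits_iff.mpr h))
      -- then `η₁` is a unit and so is `e_s² η₁ + t e_s G`
      have hη₁u : IsUnit η₁ := by
        by_contra hnu
        have hm : η₁ ∈ maximalIdeal L := (mem_maximalIdeal _).mpr (mem_nonunits_iff.mpr hnu)
        have h1 : ψ η_Q * alg (chartGen c 1 1) + ψ η_W * alg (chartGen c 1 2) + t * r₂' ∈ maximalIdeal L :=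
          Ideal.add_mem _ (Ideal.add_mem _ (Ideal.mul_mem_right _ _ hηQ') (Ideal.mul_mem_left _ _ hew))
            (Ideal.mul_mem_right _ _ ht)
        have : ψ η_S * alg (chartGen c 1 0) ∈ maximalIdeal L := by
          have := Ideal.sub_mem _ hm h1
          rwa [hη₁, show ψ η_S * alg (chartGen c 1 0) + ψ η_Q * alg (chartGen c 1 1) + ψ η_W * alg (chartGen c 1 2) +
            t * r₂' - (ψ η_Q * alg (chartGen c 1 1) + ψ η_W * alg (chartGen c 1 2) + t * r₂') =
            ψ η_S * alg (chartGen c 1 0) from by ring] at this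
        exact (maximalIdeal.isMaximal L).ne_top (Ideal.eq_top_of_isUnit_mem _ this (hηS'.mul hesU))
      refine key (v := alg (chartGen c 1 0) ^ 2 * η₁ + t * alg (chartGen c 1 0) * alg (chartGen c 1 1) ^ 3 * ψ G) ?_ ?_
      · by_contra hnu
        have hm : alg (chartGen c 1 0) ^ 2 * η₁ + t * alg (chartGen c 1 0) * alg (chartGen c 1 1) ^ 3 * ψ G ∈
            maximalIdeal L := (mem_maximalIdeal _).mpr (mem_nonunits_iff.mpr hnu)
        have : alg (chartGen c 1 0) ^ 2 * η₁ ∈ maximalIdeal L := by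
          have := Ideal.sub_mem _ hm (Ideal.mul_mem_right _ _ (Ideal.mul_mem_right _ _ (Ideal.mul_mem_right _ _ ht)) :
            t * alg (chartGen c 1 0) * alg (chartGen c 1 1) ^ 3 * ψ G ∈ maximalIdeal L)
          rwa [add_sub_cancel_right] at this
        exact (maximalIdeal.isMaximal L).ne_top (Ideal.eq_top_of_isUnit_mem _ this ((hesU.pow 2).mul hη₁u))
      · have : alg (chartGen c 1 2) ^ 2 + t * (alg (chartGen c 1 0) ^ 2 * η₁ +
            t * alg (chartGen c 1 0) * alg (chartGen c 1 1) ^ 3 * ψ G) = g₁ := by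
          rw [hg₁]; ring
        rw [this]; exact hg₁m
    -- the origin: `(t, e_s, e_w)` is a regular system of parameters
    have hes𝔴 : chartGen c 1 0 ∈ 𝔴 := (IsLocalization.AtPrime.to_map_mem_maximal_iff L 𝔴 _).mp hes
    have hew𝔴 : chartGen c 1 2 ∈ 𝔴 := (IsLocalization.AtPrime.to_map_mem_maximal_iff L 𝔴 _).mp hew
    obtain ⟨-, h3L, hgenL⟩ := chartOrigin_span_triple_eq h3 c hc (i := 0) (i' := 2) (j := 1) (by decide) (by decide)
      (by decide) 𝔴 h𝔴 hes𝔴 hew𝔴 L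
    rw [← hψ] at hgenL
    -- `η₁ ∈ 𝔪_L`
    have hη₁m : η₁ ∈ maximalIdeal L := by
      rw [hη₁]
      exact Ideal.add_mem _ (Ideal.add_mem _ (Ideal.add_mem _ (Ideal.mul_mem_left _ _ hes) (Ideal.mul_mem_right _ _ hηQ'))
        (Ideal.mul_mem_left _ _ hew)) (Ideal.mul_mem_right _ _ ht)
    refine ⟨hLreg, h3L, t, alg (chartGen c 1 0), alg (chartGen c 1 2), ψ G, t * alg (chartGen c 1 0) ^ 2 * η₁, hgenL, hG',
      ?_, ?_⟩
    · -- `t e_s² η₁ ∈ 𝔪⁴`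
      have h1 : t * alg (chartGen c 1 0) ^ 2 ∈ maximalIdeal L ^ 3 := by
        have := Ideal.mul_mem_mul ht (Ideal.pow_mem_pow hes 2)
        rwa [← pow_succ'] at this
      have := Ideal.mul_mem_mul h1 hη₁m
      rwa [← pow_succ] at this
    · rw [hI'eq, hg₁, hej]
      congr 1
      ext1
      ring_nf
  · -- chart `w`: the transform is the unit ideal — impossible
    exfalso
    have hunit : IsUnit g₁ := by
      rw [hg₁, hej, one_pow]
      by_contra hnu
      have hm : (1 : L) + (t * alg (chartGen c 2 0) ^ 2 * η₁ + t ^ 2 * alg (chartGen c 2 0) * alg (chartGen c 2 1) ^ 3 * ψ G) ∈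
          maximalIdeal L := (mem_maximalIdeal _).mpr (mem_nonunits_iff.mpr hnu)
      have h1 : t * alg (chartGen c 2 0) ^ 2 * η₁ + t ^ 2 * alg (chartGen c 2 0) * alg (chartGen c 2 1) ^ 3 * ψ G ∈
          maximalIdeal L :=
        Ideal.add_mem _ (Ideal.mul_mem_right _ _ (Ideal.mul_mem_right _ _ ht))
          (Ideal.mul_mem_right _ _ (Ideal.mul_mem_right _ _ (Ideal.mul_mem_right _ _ (Ideal.pow_mem_of_mem _ ht 2 two_pos))))
      have : (1 : L) ∈ maximalIdeal L := by
        have := Ideal.sub_mem _ hm h1; rwa [add_sub_cancel_right] at this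
      exact (maximalIdeal.isMaximal L).ne_top ((Ideal.eq_top_iff_one _).mpr this)
    have h1 : (1 : L) ∈ maximalIdeal L := by
      have hg₁I : g₁ ∈ I' := by rw [hI'eq]; exact Ideal.mem_span_singleton_self _
      have htop : I' = ⊤ := Ideal.eq_top_of_isUnit_mem _ hg₁I hunit
      have := hsing (htop ▸ Submodule.mem_top : (1 : L) ∈ I')
      exact Ideal.pow_le_self two_ne_zero this
    exact (maximalIdeal.isMaximal L).ne_top ((Ideal.eq_top_iff_one _).mpr h1)


end MohWindowSurface

end CampaignW46

end Summit.ResolutionOfSingularities.ResolutionOfSingularities.Theorems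

end
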